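import Summits.NavierStokesRegularity.NavierStokesRegularity.Theorems.EfficiencyFloorProductionEfficiencyDecayViolationStructure
import Summits.NavierStokesRegularity.NavierStokesRegularity.Theorems.EfficiencyFloorProductionEfficiencyDecayTypeIRecurrence
import HarnessLib

/-!
# Crux `EfficiencyFloor.ProductionEfficiencyDecay` (stmt-NavierStokesRegularity-22866): every LERAY-RATE
# (liminf-enstrophy-Type-I) blow-up recurs to BARKER–PRANGE SCALE-INVARIANT ENSTROPHY CONCENTRATION

`--supports stmt-NavierStokesRegularity-22866 --as helper` (line `efficiency_floor`; seat ns-ef-p4). A composition of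
two landed structure theorems of the line:

* `TypeIRecurrence.recurrence` (sibling seat ns-ef-p5): if `Z(t) ≤ W/√(T−t)` at times `t ↑ T`, then at times
  `ξ ↑ T` the enstrophy grows at the cubic rate `Z³/(4W²) ≤ Ż` (mean value theorem on `Z⁻²`) — these are
  `ε`-VIOLATION TIMES of the crux-proper stub S2 for `ε = 1/(8W²)`;
* `Violation.parabolic_concentration_at_violation` (this seat): at an `ε`-violation time a `δ`-fraction of `Z(t)`
  lies in ONE ball of parabolic radius `R'√(T−t)`, and `Z(t) ≥ c_L ν^{3/2}/√(T−t)` (Leray).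

WHAT IS PROVED (unconditional structure of a hypothetical blow-up):
* `typeI_frequent_concentration`: for all `ν, W > 0` there are `R', γ > 0` such that every maximal smooth
  Leray–Hopf rapidly-decaying-datum solution on `[0,T)` with `∫⁻|curl u(t)|² ≤ W/√(T−t)` frequently as `t ↑ T`
  satisfies, FREQUENTLY as `t ↑ T`, `γ ≤ √(T−t) · ∫_{B(a, R'√(T−t))} ‖curl u(t)‖²` for some centre `a` — the
  'initial concentration' of the scale-invariant enstrophy in Barker–Prange's strategy
  ([corpus:paper:arxiv-2211.16215 §7.2], there ASSUMED at one time under a velocity-Type-I bound; here DERIVED,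
  recurrently, from the enstrophy rate alone).
* `frequent_concentration_of_quarterLaw`: the same for a solution obeying the quarter law `Z(t) ≤ K/√(T−t)` on `[0,T)`;
* `frequent_concentration_of_enstrophyQuarterLaw`: under the route's RESIDUAL item `EnstrophyQuarterLaw` (stmt-1574, open) every maximal
  solution of the class would recur to such concentrated states.

READ-OUT FOR THE PINCER. On this line the attacked jaw (22866 ⟺ S2) fails only at violation times, and the
residual jaw (1574) forces violation times to recur; both meet in ONE typed object — a parabolic ball
`B(a, R'√(T−t))` holding scale-invariant enstrophy `≥ γ`, recurring as `t ↑ T`. The missing theorem of the line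
is an EXIT/NO-RETURN estimate for that object (not proved anywhere; open-problem grade).

HONEST FRAMING: nothing here asserts that a blow-up exists; the crux stmt-22866 and the residual stmt-1574 are NOT
proved; NS regularity is NOT proved; no summit is proved. [folklore]
-/

-- the problem directory repeats the summit name (`NavierStokesRegularity/NavierStokesRegularity`)
set_option linter.dupNamespace false

noncomputable section

open Set Filter MeasureTheory Topology
open scoped InnerProductSpace ENNReal NNReal
open Literature.Analysis.FluidPDE

namespace Summit.NavierStokesRegularity.NavierStokesRegularity.Theorems

namespace ProductionEfficiencyDecay

namespace Violation

/-- **Leray-rate blow-up recurs to Barker–Prange concentration.** For all `ν, W > 0` there are `R', γ > 0` such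
that along every maximal smooth Leray–Hopf rapidly-decaying-datum solution on `[0,T)` whose enstrophy satisfies
`∫⁻|curl u(t)|² ≤ W/√(T−t)` frequently as `t ↑ T`, frequently as `t ↑ T` some parabolic ball carries
scale-invariant enstrophy `γ ≤ √(T−t) ∫_{B(a,R'√(T−t))} ‖curl u(t)‖²` (`γ = δ c_L ν^{3/2}` with `δ` from
stmt-23111 at `θ(ν, 1/(8W²))`). A structure statement about a hypothetical blow-up. [folklore] -/
theorem typeI_frequent_concentration :
    ∀ (ν W : ℝ), 0 < ν → 0 < W → ∃ R' γ : ℝ, 0 < R' ∧ 0 < γ ∧ ∀ (T : ℝ), 0 < T →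
      ∀ (u : ℝ → EuclideanSpace ℝ (Fin 3) → EuclideanSpace ℝ (Fin 3)) (p : ℝ → EuclideanSpace ℝ (Fin 3) → ℝ),
        Literature.Analysis.FluidPDE.IsMaximalSmoothSolution ν 0 u p T →
        Literature.Analysis.FluidPDE.IsLerayHopfOn T ν 0 (u 0) u →
        Literature.Analysis.FluidPDE.HasRapidSpatialDecay (u 0) →
        (∃ᶠ t in 𝓝[<] T, ∫⁻ x, ‖Literature.Analysis.FluidPDE.curl (u t) x‖ₑ ^ 2 ≤
          ENNReal.ofReal (W / Real.sqrt (T - t))) →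
        ∃ᶠ t in 𝓝[<] T, ∃ a : EuclideanSpace ℝ (Fin 3),
          γ ≤ Real.sqrt (T - t) *
            ∫ x in Metric.ball a (R' * Real.sqrt (T - t)), ‖Literature.Analysis.FluidPDE.curl (u t) x‖ ^ 2 := by
  obtain ⟨c, hc, hB⟩ := EnstrophyBudget.main
  obtain ⟨cL, hcL, hfl⟩ := leray_floor_real
  intro ν W hν hW
  have hε : (0 : ℝ) < 1 / (8 * W ^ 2) := by positivity
  obtain ⟨R', δ, hR', hδ, hcon⟩ := parabolic_concentration_at_violation c ν (1 / (8 * W ^ 2)) hc hν hε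
  refine ⟨R', δ * (cL * ν ^ (3 / 2 : ℝ)), hR', by positivity, ?_⟩
  intro T hT u p hmax hLH hdec hfreq
  obtain ⟨Zr, Pr, Sr, hZ⟩ := hB ν T hν hT u p hmax hLH hdec
  have hrec := TypeIRecurrence.recurrence hν hT hmax hLH hdec (fun t ht => (hZ t ht).1)
    (fun t ht => (hZ t ht).2.1) (fun t ht => (hZ t ht).2.2.2.2.2.1) hW hfreq
  refine hrec.mono ?_
  rintro t ⟨ht, hZpos, hgrow⟩
  -- a growth instant is a `1/(8W²)`-violation time
  have hv : 1 / (8 * W ^ 2) * Zr t ^ 3 < 2 * Sr t - 2 * ν * Pr t := by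
    have hZ3 : 0 < Zr t ^ 3 := pow_pos hZpos 3
    have h1 : 1 / (8 * W ^ 2) * Zr t ^ 3 < Zr t ^ 3 / (4 * W ^ 2) := by
      rw [one_div, inv_mul_eq_div, div_lt_div_iff₀ (by positivity) (by positivity)]
      nlinarith [mul_pos hZ3 (pow_pos hW 2)]
    exact h1.trans_le hgrow
  obtain ⟨a, ha⟩ := hcon T hT u p hmax hLH hdec Zr Pr Sr hZ t ht hv
  refine ⟨a, ?_⟩
  have hfloor := hfl ν T hν hT u p hmax hLH hdec Zr (fun s hs => ⟨(hZ s hs).1, (hZ s hs).2.1⟩) t ht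
  have hTt : 0 < T - t := sub_pos.2 ht.2
  have hs : 0 < Real.sqrt (T - t) := Real.sqrt_pos.2 hTt
  have h1 : cL * ν ^ (3 / 2 : ℝ) ≤ Zr t * Real.sqrt (T - t) := by
    rw [Real.rpow_neg hTt.le, ← Real.sqrt_eq_rpow] at hfloor
    have := mul_le_mul_of_nonneg_right hfloor hs.le
    rwa [mul_assoc, inv_mul_cancel₀ hs.ne', mul_one] at this
  calc δ * (cL * ν ^ (3 / 2 : ℝ)) ≤ δ * (Zr t * Real.sqrt (T - t)) := mul_le_mul_of_nonneg_left h1 hδ.le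
    _ = Real.sqrt (T - t) * (δ * Zr t) := by ring
    _ ≤ Real.sqrt (T - t) * ∫ x in Metric.ball a (R' * Real.sqrt (T - t)), ‖curl (u t) x‖ ^ 2 :=
        mul_le_mul_of_nonneg_left ha hs.le

/-- **Under the quarter law for one solution** (`Z(t) ≤ K/√(T−t)` on `[0,T)`, the conclusion of the route's
residual `EnstrophyQuarterLaw` for THIS solution): frequently as `t ↑ T` some parabolic ball `B(a, R'√(T−t))`
carries scale-invariant enstrophy `≥ γ`, with the constants of `typeI_frequent_concentration` at `W = max K 1`.
[folklore] -/
theorem frequent_concentration_of_quarterLaw {ν K : ℝ} (hν : 0 < ν) :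
    ∃ R' γ : ℝ, 0 < R' ∧ 0 < γ ∧ ∀ (T : ℝ), 0 < T →
      ∀ (u : ℝ → EuclideanSpace ℝ (Fin 3) → EuclideanSpace ℝ (Fin 3)) (p : ℝ → EuclideanSpace ℝ (Fin 3) → ℝ),
        Literature.Analysis.FluidPDE.IsMaximalSmoothSolution ν 0 u p T →
        Literature.Analysis.FluidPDE.IsLerayHopfOn T ν 0 (u 0) u →
        Literature.Analysis.FluidPDE.HasRapidSpatialDecay (u 0) →
        (∀ t ∈ Set.Ico 0 T, ∫⁻ x, ‖Literature.Analysis.FluidPDE.curl (u t) x‖ₑ ^ 2 ≤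
          ENNReal.ofReal (K / Real.sqrt (T - t))) →
        ∃ᶠ t in 𝓝[<] T, ∃ a : EuclideanSpace ℝ (Fin 3),
          γ ≤ Real.sqrt (T - t) *
            ∫ x in Metric.ball a (R' * Real.sqrt (T - t)), ‖Literature.Analysis.FluidPDE.curl (u t) x‖ ^ 2 := by
  obtain ⟨R', γ, hR', hγ, h⟩ := typeI_frequent_concentration ν (max K 1) hν (lt_max_of_lt_right one_pos)
  refine ⟨R', γ, hR', hγ, fun T hT u p hmax hLH hdec hq => h T hT u p hmax hLH hdec ?_⟩
  have hev : ∀ᶠ t in 𝓝[<] T, ∫⁻ x, ‖curl (u t) x‖ₑ ^ 2 ≤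
      ENNReal.ofReal (max K 1 / Real.sqrt (T - t)) := by
    filter_upwards [Ico_mem_nhdsLT hT] with t ht
    refine (hq t ht).trans (ENNReal.ofReal_le_ofReal ?_)
    exact div_le_div_of_nonneg_right (le_max_left _ _) (Real.sqrt_nonneg _)
  exact hev.frequently

/-- **Under the route's residual item `EnstrophyQuarterLaw` (stmt-1574, open)**: every maximal smooth Leray–Hopf
rapidly-decaying-datum solution of finite lifespan would recur, as `t ↑ T`, to states with Barker–Prange
scale-invariant enstrophy `≥ γ` in one parabolic ball. A CONDITIONAL structure statement; the residual is open;
nothing about NS regularity is asserted. [folklore] -/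
theorem frequent_concentration_of_enstrophyQuarterLaw
    (hQ : Summit.NavierStokesRegularity.NavierStokesRegularity.Theses.EfficiencyFloor.EnstrophyQuarterLaw)
    {ν T : ℝ} (hν : 0 < ν) (hT : 0 < T)
    {u : ℝ → EuclideanSpace ℝ (Fin 3) → EuclideanSpace ℝ (Fin 3)} {p : ℝ → EuclideanSpace ℝ (Fin 3) → ℝ}
    (hmax : IsMaximalSmoothSolution ν 0 u p T) (hLH : IsLerayHopfOn T ν 0 (u 0) u)
    (hdec : HasRapidSpatialDecay (u 0)) :
    ∃ R' γ : ℝ, 0 < R' ∧ 0 < γ ∧ ∃ᶠ t in 𝓝[<] T, ∃ a : EuclideanSpace ℝ (Fin 3),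
      γ ≤ Real.sqrt (T - t) * ∫ x in Metric.ball a (R' * Real.sqrt (T - t)), ‖curl (u t) x‖ ^ 2 := by
  obtain ⟨K, hK⟩ := hQ ν T hν hT u p hmax hLH hdec
  obtain ⟨R', γ, hR', hγ, h⟩ := frequent_concentration_of_quarterLaw (K := K) hν
  exact ⟨R', γ, hR', hγ, h T hT u p hmax hLH hdec hK⟩

end Violation

end ProductionEfficiencyDecay

end Summit.NavierStokesRegularity.NavierStokesRegularity.Theorems

end
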